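import Summits.CriticalPhenomena.Ising3D.TaylorRegionLitPieces
import Mathlib.Tactic.Linarith
import Mathlib.Tactic.Positivity
import Mathlib.Tactic.Ring
import HarnessLib

/-!
# The even region from FULLY SPLIT Booleans: sizes, literal `(E, θ)` tables, per-cell discriminant tail, per-row containment, pieces
(cell `pub-ising3x`, seat recog-1 gen 12; gate (g2) — certificate-file shape, even sector)

HONEST FRAMING: lottery ticket; floor = tightest certified 3D Ising CFT bounds; no exact-solution
claim without a proof. Island framing: certified exclusion region at stated derivative order and
assumptions; not a determination of the 3D Ising critical exponents beyond that.

`TaylorRegionLitPieces` split the BOUNDED part of the even region check into per-piece declarations but kept ONE prefix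
Boolean (`prefixOKL`: sizes + the three `(E, θ)` tails on COMPUTED tables + containment of every computed row in its
literal). At a real `Λ = 11` size that prefix does three table builds plus `J₁ + 1` row containments plus the whole
discriminant tail in one declaration, which can exceed the measured per-declaration kernel cutoff (≈ 170–190 s). Here every
conjunct becomes its own hypothesis: `sizesOK` (no table work), `tailLitOK LT` (containment of the three computed `(E, θ)`
tables in producer literals `LT = (LTX, LTY, LTZ)`, checked once — or `tailLitOK_self` with the computed tables), `tailXOKL` /
`tailYOKL` (the `X`, `Y` tails on the literals), `tailDCellOKL LT k` (ONE θ-cell of the discriminant tail, one declaration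
each), `rowLitOK L j` (containment of row `j`'s computed rows in its literals, one declaration per `j` or per chunk) and the
landed `pieceOK L K j k`. **`taylorEvenRegion_of_split`** assembles them into `TaylorEvenRegion`; turnkey
`taylorEvenRegion_of_certSplit`, glue `TaylorTable.evenRegion_of_evenCertSplit`. `subset2I` / `pmem2_of_subset2I` /
`subsetI_self` are the list lemmas. Elementary. [folklore]
-/

namespace Summit.CriticalPhenomena.Ising3D

open Finset Set
open Literature.Analysis.ValidatedNumerics Literature.Analysis.ValidatedNumerics.PolyMP
open Literature.Analysis.ValidatedNumerics.NumericsMP (MI)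
open Literature.MathematicalPhysics.QuantumFieldTheory.ConformalBootstrap3D

/-! ### Containment of interval tables in literals -/

/-- Row-wise `subsetI`. [folklore] -/
def subset2I : IPoly2 → IPoly2 → Bool
  | [], [] => true
  | P :: T, Q :: L => subsetI P Q && subset2I T L
  | _, _ => false

/-- [folklore] -/
theorem pmem2_of_subset2I {S : ℕ} : ∀ {G : List (List ℝ)} {T L : IPoly2}, PMem2 S G T → subset2I T L = true → PMem2 S G L
  | _, _, L, List.Forall₂.nil, h => by
      cases L with
      | nil => exact pmem2_nil S
      | cons Q L => simp [subset2I] at h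
  | _, _, L, List.Forall₂.cons (a := g) (b := P) (l₁ := G) (l₂ := T) hg hT, h => by
      cases L with
      | nil => simp [subset2I] at h
      | cons Q L =>
        simp only [subset2I, Bool.and_eq_true] at h
        exact List.Forall₂.cons (pmem_of_subsetI hg h.1) (pmem2_of_subset2I hT h.2)

/-- [folklore] -/
theorem subsetI_self : ∀ P : IPoly, subsetI P P = true
  | [] => rfl
  | I :: P => by simp only [subsetI, Bool.and_eq_true, decide_eq_true_eq]; exact ⟨⟨le_rfl, le_rfl⟩, subsetI_self P⟩

/-- [folklore] -/
theorem subset2I_self : ∀ T : IPoly2, subset2I T T = true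
  | [] => rfl
  | P :: T => by simp only [subset2I, Bool.and_eq_true]; exact ⟨subsetI_self P, subset2I_self T⟩

/-- `halfStripPosD` from its θ-cells. [folklore] -/
theorem halfStripPosD_of_cells {S : ℕ} {HX HY HZ : IPoly2} {P0 : ℚ} {prm : HSParams} (hθ : 0 < prm.θhi)
    (hn : 0 < prm.nθ)
    (h : ∀ k : ℕ, k < prm.nθ →
      cellOKD S HX HY HZ (effCols HX (rowMax2I HX)) (effCols HY (rowMax2I HY)) (effCols HZ (rowMax2I HZ))
        P0 prm.P1 (prm.θhi * (2 * (k : ℚ) + 1) / (2 * (prm.nθ : ℚ))) (prm.θhi / (2 * (prm.nθ : ℚ))) prm.dP = true) :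
    halfStripPosD S HX HY HZ P0 prm = true := by
  simp only [halfStripPosD, Bool.and_eq_true, decide_eq_true_eq, List.all_eq_true, List.mem_range]
  exact ⟨⟨hθ, hn⟩, h⟩

/-! ### The split Booleans -/

namespace EvenRegionDataH

/-- Sizes and parameter sanity (no table is evaluated beyond `kernelSizeOK`). [folklore] -/
def sizesOK (d : EvenRegionDataH) : Bool :=
  decide (0 < d.S) && decide (0 < d.E0) && decide (d.E1 ≤ (d.J1 : ℚ) + 1) && momLenOK d.N d.R &&
  kernelSizeOK d.S (d.cQ 0) (-1) d.sσI d.ccQ d.l d.N && kernelSizeOK d.S (d.cQ 1) (-1) d.sεI d.ccQ d.l d.N &&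
  kernelSizeOK d.S (d.cQ 3) (-1) d.sbI d.ccQ d.l d.N && kernelSizeOK d.S (d.cQ 4) 1 d.sbI d.ccQ d.l d.N &&
  decide (1 ≤ d.prmX.θhi) && decide (1 ≤ d.prmY.θhi) && decide (1 ≤ d.prmD.θhi) && decide (0 < d.prmD.nθ)

/-- Containment of the three computed `(E, θ)` tables in the producer literals `LT = (LTX, LTY, LTZ)`. [folklore] -/
def tailLitOK (d : EvenRegionDataH) (LT : IPoly2 × IPoly2 × IPoly2) : Bool :=
  subset2I d.TX LT.1 && subset2I d.TY LT.2.1 && subset2I d.TZ LT.2.2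

/-- The `X` tail on the literal table. [folklore] -/
def tailXOKL (d : EvenRegionDataH) (LT : IPoly2 × IPoly2 × IPoly2) : Bool :=
  halfStripPos2 d.S LT.1 (d.E1 - d.ccQ) d.prmX

/-- The `Y` tail on the literal table. [folklore] -/
def tailYOKL (d : EvenRegionDataH) (LT : IPoly2 × IPoly2 × IPoly2) : Bool :=
  halfStripPos2 d.S LT.2.1 (d.E1 - d.ccQ) d.prmY

/-- The `k`-th θ-cell of the discriminant tail on the literal tables. [folklore] -/
def tailDCellOKL (d : EvenRegionDataH) (LT : IPoly2 × IPoly2 × IPoly2) (k : ℕ) : Bool :=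
  cellOKD d.S LT.1 LT.2.1 LT.2.2 (effCols LT.1 (rowMax2I LT.1)) (effCols LT.2.1 (rowMax2I LT.2.1))
    (effCols LT.2.2 (rowMax2I LT.2.2)) (d.E1 - d.ccQ) d.prmD.P1
    (d.prmD.θhi * (2 * (k : ℚ) + 1) / (2 * (d.prmD.nθ : ℚ))) (d.prmD.θhi / (2 * (d.prmD.nθ : ℚ))) d.prmD.dP

/-- Containment of row `j`'s three computed rows in the literal rows `L[j]`. [folklore] -/
def rowLitOK (d : EvenRegionDataH) (L : List (IPoly × IPoly × IPoly)) (j : ℕ) : Bool :=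
  subsetI (d.PX j) (L.getD j ([], [], [])).1 && subsetI (d.PY j) (L.getD j ([], [], [])).2.1 &&
    subsetI (d.PZ j) (L.getD j ([], [], [])).2.2

/-- With the computed tables as their own literals the containment holds without evaluation. [folklore] -/
theorem tailLitOK_self (d : EvenRegionDataH) : d.tailLitOK (d.TX, d.TY, d.TZ) = true := by
  simp only [tailLitOK, Bool.and_eq_true]; exact ⟨⟨subset2I_self _, subset2I_self _⟩, subset2I_self _⟩

end EvenRegionDataH

/-- **The even region from the split Booleans** (statement of `taylorEvenRegion_of_evenRegionCheckH`). [folklore] -/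
theorem taylorEvenRegion_of_split (d : EvenRegionDataH) (LT : IPoly2 × IPoly2 × IPoly2)
    (L : List (IPoly × IPoly × IPoly)) {K : ℕ} (hK : 0 < K) (hl : d.l.Nodup) (Q : Set (ℝ × ℝ))
    (hQ : ∀ p ∈ Q, MI.mem d.S p.1 d.sσI ∧ MI.mem d.S p.2 d.sεI ∧ MI.mem d.S ((p.1 + p.2) / 2) d.sbI)
    (hs : d.sizesOK = true) (hLT : d.tailLitOK LT = true) (hX : d.tailXOKL LT = true) (hY : d.tailYOKL LT = true)
    (hD : ∀ k : ℕ, k < d.prmD.nθ → d.tailDCellOKL LT k = true)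
    (hr : ∀ j : ℕ, j < d.J1 + 1 → d.rowLitOK L j = true)
    (hpc : ∀ j k : ℕ, j < d.J1 + 1 → k < K → d.pieceOK L K j k = true) :
    TaylorEvenRegion (taylorCrossing (1 / 2) (1 / 2) d.l.toFinset fun i ab => (d.cQ i ab : ℝ)) Q ((d.E0 : ℚ) : ℝ) := by
  simp only [EvenRegionDataH.sizesOK, Bool.and_eq_true, decide_eq_true_eq] at hs
  obtain ⟨⟨⟨⟨⟨⟨⟨⟨⟨⟨⟨hS, hE0⟩, hJ1⟩, hR⟩, hN0⟩, hN1⟩, hN3⟩, hN4⟩, hθX⟩, hθY⟩, hθD⟩, hnD⟩ := hs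
  simp only [EvenRegionDataH.tailLitOK, Bool.and_eq_true] at hLT
  obtain ⟨⟨cX, cY⟩, cZ⟩ := hLT
  have hDall : halfStripPosD d.S LT.1 LT.2.1 LT.2.2 (d.E1 - d.ccQ) d.prmD = true :=
    halfStripPosD_of_cells (lt_of_lt_of_le zero_lt_one hθD) hnD hD
  refine taylorEvenRegion_half_of_qRegion _ _ Q _ fun p hp E j hE hj => ?_
  obtain ⟨hsσ, hsε, hsb⟩ := hQ p hp
  have hEpos : 0 < E := lt_of_lt_of_le (by exact_mod_cast hE0) hE
  by_cases hE1 : ((d.E1 : ℚ) : ℝ) ≤ E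
  · -- tail: (E, θ) tables, through the literals
    have hθ := div_mem_unit hEpos hj
    have hP : ((d.E1 - d.ccQ : ℚ) : ℝ) ≤ E - d.ccQ := by push_cast; linarith
    have eX := qSum_eq_eval2_momTable hS (d.cQ 0) (-1) hsσ d.ccQ hl hN0 hR hEpos j
    have eY := qSum_eq_eval2_momTable hS (d.cQ 1) (-1) hsε d.ccQ hl hN1 hR hEpos j
    have eZ3 := qSum_eq_eval2_momTable hS (d.cQ 3) (-1) hsb d.ccQ hl hN3 hR hEpos j
    have eZ4 := qSum_eq_eval2_momTable hS (d.cQ 4) 1 hsb d.ccQ hl hN4 hR hEpos j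
    have pX := pmem2_of_subset2I (pmem2_momTableI hS (d.cQ 0) (-1) hsσ d.ccQ d.l d.N d.R) cX
    have pY := pmem2_of_subset2I (pmem2_momTableI hS (d.cQ 1) (-1) hsε d.ccQ d.l d.N d.R) cY
    have pZ := pmem2_of_subset2I (pmem2_add2I (pmem2_momTableI hS (d.cQ 3) (-1) hsb d.ccQ d.l d.N d.R)
      (pmem2_momTableI hS (d.cQ 4) 1 hsb d.ccQ d.l d.N d.R)) cZ
    have vX := halfStripPos2_sound hS pX hX hP hθ.1 (hθ.2.trans (by exact_mod_cast hθX))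
    have vY := halfStripPos2_sound hS pY hY hP hθ.1 (hθ.2.trans (by exact_mod_cast hθY))
    have vD := halfStripPosD_sound hS pX pY pZ hDall hP hθ.1 (hθ.2.trans (by exact_mod_cast hθD))
    rw [eval2_add2] at vD
    simp only [Rat.cast_neg, Rat.cast_one] at eX eY eZ3 eZ4
    have goalD : (qSum (fun ab => (d.cQ 3 ab : ℝ)) d.l.toFinset ((p.1 + p.2) / 2) (-1) E j +
        qSum (fun ab => (d.cQ 4 ab : ℝ)) d.l.toFinset ((p.1 + p.2) / 2) 1 E j) ^ 2 ≤
        4 * qSum (fun ab => (d.cQ 0 ab : ℝ)) d.l.toFinset p.1 (-1) E j *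
          qSum (fun ab => (d.cQ 1 ab : ℝ)) d.l.toFinset p.2 (-1) E j := by
      rw [eX, eY, eZ3, eZ4, sq]; linarith
    exact ⟨by rw [eX]; exact vX.le, by rw [eY]; exact vY.le, goalD⟩
  · -- bounded part: literal rows (containment per row) and the pieces
    have hElt : E < d.E1 := lt_of_not_ge hE1
    have hjJ : j < d.J1 + 1 := by
      have h1 : (j : ℝ) < (d.J1 : ℝ) + 1 := by
        have : ((d.E1 : ℚ) : ℝ) ≤ (d.J1 : ℝ) + 1 := by exact_mod_cast hJ1
        linarith
      exact_mod_cast h1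
    have hrow := hr j hjJ
    simp only [EvenRegionDataH.rowLitOK, Bool.and_eq_true] at hrow
    obtain ⟨⟨sX, sY⟩, sZ⟩ := hrow
    have pX := pmem_of_subsetI
      (pmem_qRowOfTableI (pmem2_kernelPDLI_of_mem hS hsσ (d.cQ 0) (-1) d.ccQ d.l) d.N j) sX
    have pY := pmem_of_subsetI
      (pmem_qRowOfTableI (pmem2_kernelPDLI_of_mem hS hsε (d.cQ 1) (-1) d.ccQ d.l) d.N j) sY
    have pZ := pmem_of_subsetI
      (pmem_addI (pmem_qRowOfTableI (pmem2_kernelPDLI_of_mem hS hsb (d.cQ 3) (-1) d.ccQ d.l) d.N j)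
        (pmem_qRowOfTableI (pmem2_kernelPDLI_of_mem hS hsb (d.cQ 4) 1 d.ccQ d.l) d.N j)) sZ
    have hmE2 : max (d.E0 : ℝ) (j : ℝ) ≤ E := max_le hE hj
    have hmE : ((max d.E0 (j : ℚ) : ℚ) : ℝ) ≤ E := by push_cast; exact hmE2
    have hm1 : max d.E0 (j : ℚ) ≤ d.E1 := by
      have : ((max d.E0 (j : ℚ) : ℚ) : ℝ) ≤ ((d.E1 : ℚ) : ℝ) := hmE.trans hElt.le
      exact_mod_cast this
    have hw : 0 ≤ (d.E1 - max d.E0 (j : ℚ)) / (K : ℚ) := div_nonneg (by linarith) (by positivity)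
    have hmono : ∀ k : ℕ, d.pieceLo K j k ≤ d.pieceLo K j (k + 1) := fun k => by
      unfold EvenRegionDataH.pieceLo; push_cast; nlinarith
    have e0 : d.pieceLo K j 0 = max d.E0 (j : ℚ) - d.ccQ := by unfold EvenRegionDataH.pieceLo; simp
    have hKq : (K : ℚ) ≠ 0 := by exact_mod_cast hK.ne'
    have eK : d.pieceLo K j K = d.E1 - d.ccQ := by
      unfold EvenRegionDataH.pieceLo; field_simp; ring
    have hn1 : K - 1 + 1 = K := Nat.sub_add_cancel hK
    obtain ⟨k, hk, hk1, hk2⟩ := exists_mem_gridCell (fun k : ℕ => ((d.pieceLo K j k : ℚ) : ℝ)) (K - 1)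
      (Δ := E - d.ccQ) (by show ((d.pieceLo K j 0 : ℚ) : ℝ) ≤ E - d.ccQ; rw [e0]; push_cast; linarith [hmE2])
      (by show E - d.ccQ ≤ ((d.pieceLo K j (K - 1 + 1) : ℚ) : ℝ); rw [hn1, eK]; push_cast; linarith)
    have hkK : k < K := by omega
    have hpiece := hpc j k hjJ hkK
    simp only [EvenRegionDataH.pieceOK, Bool.or_eq_true, Bool.and_eq_true, decide_eq_true_eq] at hpiece
    rcases hpiece with hvac | ⟨⟨rX, rY⟩, rD⟩
    · exfalso
      have : ((d.E1 : ℚ) : ℝ) < ((max d.E0 (j : ℚ) : ℚ) : ℝ) := by exact_mod_cast hvac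
      linarith
    have vX := posOn_sound hS rX (hmono k) pX hk1 hk2
    have vY := posOn_sound hS rY (hmono k) pY hk1 hk2
    have vD := posOnD_sound hS pX pY pZ rD (hmono k) hk1 hk2
    rw [evalR_addR] at vD
    have eX := qSum_eq_evalR_qRowOfTable hS (d.cQ 0) (-1) hsσ d.ccQ hl hN0 E j
    have eY := qSum_eq_evalR_qRowOfTable hS (d.cQ 1) (-1) hsε d.ccQ hl hN1 E j
    have eZ3 := qSum_eq_evalR_qRowOfTable hS (d.cQ 3) (-1) hsb d.ccQ hl hN3 E j
    have eZ4 := qSum_eq_evalR_qRowOfTable hS (d.cQ 4) 1 hsb d.ccQ hl hN4 E j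
    simp only [Rat.cast_neg, Rat.cast_one] at eX eY eZ3 eZ4 vX vY vD
    have goalD : (qSum (fun ab => (d.cQ 3 ab : ℝ)) d.l.toFinset ((p.1 + p.2) / 2) (-1) E j +
        qSum (fun ab => (d.cQ 4 ab : ℝ)) d.l.toFinset ((p.1 + p.2) / 2) 1 E j) ^ 2 ≤
        4 * qSum (fun ab => (d.cQ 0 ab : ℝ)) d.l.toFinset p.1 (-1) E j *
          qSum (fun ab => (d.cQ 1 ab : ℝ)) d.l.toFinset p.2 (-1) E j := by
      rw [eX, eY, eZ3, eZ4, sq]; linarith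
    exact ⟨by rw [eX]; exact vX.le, by rw [eY]; exact vY.le, goalD⟩

/-! ### Turnkey and `TaylorTable` glue -/

/-- [folklore] -/
theorem taylorEvenRegion_of_certSplit (c : EvenRegionCertH) (LT : IPoly2 × IPoly2 × IPoly2)
    (L : List (IPoly × IPoly × IPoly)) {K : ℕ} (hK : 0 < K) (hl : c.l.Nodup)
    (hs : c.data.sizesOK = true) (hLT : c.data.tailLitOK LT = true) (hX : c.data.tailXOKL LT = true)
    (hY : c.data.tailYOKL LT = true) (hD : ∀ k : ℕ, k < c.data.prmD.nθ → c.data.tailDCellOKL LT k = true)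
    (hr : ∀ j : ℕ, j < c.data.J1 + 1 → c.data.rowLitOK L j = true)
    (hp : ∀ j k : ℕ, j < c.data.J1 + 1 → k < K → c.data.pieceOK L K j k = true) :
    TaylorEvenRegion (taylorCrossing (1 / 2) (1 / 2) c.l.toFinset fun i ab => (c.cQ i ab : ℝ))
      (Icc (c.box.σlo : ℝ) c.box.σhi ×ˢ Icc (c.box.εlo : ℝ) c.box.εhi) ((c.E0 : ℚ) : ℝ) := by
  refine taylorEvenRegion_of_split c.data LT L hK hl _ (fun p hp => ?_) hs hLT hX hY hD hr hp
  obtain ⟨h1, h2, h3, h4⟩ := BoxQ.bounds (B := c.box) hp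
  refine ⟨mem_enclQ _ h1 h2, mem_enclQ _ h3 h4, mem_enclQ _ ?_ ?_⟩
  · push_cast; linarith
  · push_cast; linarith

namespace TaylorTable

variable (T : TaylorTable)

/-- **The table's even region from the split Booleans.** [folklore] -/
theorem evenRegion_of_evenCertSplit (π : EvenRegionParamsH) (LT : IPoly2 × IPoly2 × IPoly2)
    (L : List (IPoly × IPoly × IPoly)) {K : ℕ} (hK : 0 < K) (hl : (T.evenCertH π).l.Nodup)
    (hs : (T.evenCertH π).data.sizesOK = true) (hLT : (T.evenCertH π).data.tailLitOK LT = true)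
    (hX : (T.evenCertH π).data.tailXOKL LT = true) (hY : (T.evenCertH π).data.tailYOKL LT = true)
    (hD : ∀ k : ℕ, k < (T.evenCertH π).data.prmD.nθ → (T.evenCertH π).data.tailDCellOKL LT k = true)
    (hr : ∀ j : ℕ, j < (T.evenCertH π).data.J1 + 1 → (T.evenCertH π).data.rowLitOK L j = true)
    (hp : ∀ j k : ℕ, j < (T.evenCertH π).data.J1 + 1 → k < K → (T.evenCertH π).data.pieceOK L K j k = true) :
    TaylorEvenRegion T.α T.box ((T.E₀ : ℚ) : ℝ) :=
  taylorEvenRegion_of_certSplit (T.evenCertH π) LT L hK hl hs hLT hX hY hD hr hp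

end TaylorTable

/-! ### Fixture: the toy through the split Booleans (`K = 2`, computed tables as their own literals) -/

/-- [folklore] -/
def toyEvenLT : IPoly2 × IPoly2 × IPoly2 :=
  (toyEvenRegionCertH.data.TX, toyEvenRegionCertH.data.TY, toyEvenRegionCertH.data.TZ)

/-- [folklore] -/
theorem toyEven_sizesOK : toyEvenRegionCertH.data.sizesOK = true := by decide +kernel

/-- [folklore] -/
theorem toyEven_tailXOKL : toyEvenRegionCertH.data.tailXOKL toyEvenLT = true := by decide +kernel

/-- [folklore] -/
theorem toyEven_tailYOKL : toyEvenRegionCertH.data.tailYOKL toyEvenLT = true := by decide +kernel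

/-- [folklore] -/
theorem toyEven_tailDCells : ∀ k : ℕ, k < toyEvenRegionCertH.data.prmD.nθ →
    toyEvenRegionCertH.data.tailDCellOKL toyEvenLT k = true := by
  have hn : toyEvenRegionCertH.data.prmD.nθ = 1 := by decide
  intro k hk
  rw [hn] at hk
  interval_cases k
  decide +kernel

/-- [folklore] -/
theorem toyEven_rows : ∀ j : ℕ, j < toyEvenRegionCertH.data.J1 + 1 →
    toyEvenRegionCertH.data.rowLitOK toyEvenLits j = true := by
  have hJ : toyEvenRegionCertH.data.J1 + 1 = 9 := by decide
  intro j hj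
  rw [hJ] at hj
  interval_cases j <;> decide +kernel

/-- The toy's even region again, now through the split route (an `example`: the statement is the landed
`toyEven_region_of_pieces`). [folklore] -/
example :
    TaylorEvenRegion (taylorCrossing (1 / 2) (1 / 2) toyEvenRegionCertH.l.toFinset fun i ab => (toyEvenRegionCertH.cQ i ab : ℝ))
      (Icc (toyEvenRegionCertH.box.σlo : ℝ) toyEvenRegionCertH.box.σhi ×ˢ
        Icc (toyEvenRegionCertH.box.εlo : ℝ) toyEvenRegionCertH.box.εhi) ((toyEvenRegionCertH.E0 : ℚ) : ℝ) :=
  taylorEvenRegion_of_certSplit toyEvenRegionCertH toyEvenLT toyEvenLits (K := 2) (by norm_num) (by decide)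
    toyEven_sizesOK (toyEvenRegionCertH.data.tailLitOK_self) toyEven_tailXOKL toyEven_tailYOKL toyEven_tailDCells
    toyEven_rows toyEven_pieces

end Summit.CriticalPhenomena.Ising3D
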